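import Summits.BirchSwinnertonDyer.Rank1Residual.Additive.X4ExoticWildArms
import Summits.BirchSwinnertonDyer.Rank1Residual.Additive.X4MThreeUpperHalfTowerFree
import Summits.BirchSwinnertonDyer.Rank1Residual.GaloisImage.J1728NotSurjThree
import HarnessLib

/-!
# The EXOTIC residue of X4 at `3` sits EXACTLY at Elkies' value `v₃(j − 1728) = 3`
# (cell `b2b-bsdres`, team n1011, seat p14 gen 3 — sequel of `Additive/X4ExoticWildArms.lean`
# p264500: the junk disjunct `padicValRat 3 (j − 1728) = 0` of the two-arm signature is removed)

HONEST FRAMING (cell `b2b-bsdres`, run/shared/lean/b2b/bsd-rank1-residual/, verbatim in every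
file): the goal of the cell is to DELETE the COMBINATION-SHAPED residual classes of the
Birch–Swinnerton-Dyer formula for ALL analytic-rank `≤ 1` elliptic curves over `ℚ` — "full BSD
formula for every rank `≤ 1` curve in class `C`" assembled STRICTLY from published theorems — so
that the rank-`≤ 1` remainder becomes exactly the CONSTRUCTION-SHAPED classes, which are TYPED
(missing-input `Prop`s), NOT attempted. This is not "finishing BSD". Team n1011 (N10 / N11, the
additive block X4 ∧ `p = 3`): research route; no claim beyond the stated classes; the label X4 is
UNCHANGED by this file; nothing is booked. Theorems only (no definition, no named fact minted; every
published input of the end-state is an explicit named-fact hypothesis, as in p250513 / p251574).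

## What this file proves

p264500 (`ClassX4.exotic_arms_of_not_towerSurj_three`) left the alternative
`v₃(j − 1728) = 3 ∨ v₃(j − 1728) = 0` on an EXOTIC row (X4 at `3`, `ρ̄_{E,3}` onto, `3`-adic tower
failing); the second disjunct is Mathlib's junk value at `j = 1728` together with `v₃(j) = 0`.  Both
are now excluded in the kernel:

* `padicValRat_j_sub_1728_pos` — `j = 0 ∨ v₃(j) ≥ 1`, `j ≠ 1728` ⟹ `v₃(j − 1728) ≥ 1`;
* **`ClassX4.padicValRat_j_sub_eq_three_of_not_towerSurj_three`** — X4 at `3` ∧ surj(3) ∧ tower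
  fails ⟹ **`v₃(j − 1728) = 3`** exactly: `v₃(j) = 0` is excluded by p249389
  (`ClassX4.j_eq_zero_or_padicValRat_j_pos_of_not_towerSurj`: the semistable-twist tower off `3 ∣ j`)
  and `j = 1728` by `GaloisImage.j_ne_1728_of_surj_three` (a `j = 1728` curve has CM by `ℤ[i]` and is
  never surj(3));
* `ClassX4.towerSurj_three_of_surj_of_padicValRat_j_sub_ne` — contrapositive: on X4 at `3`,
  surj(3) ∧ `v₃(j − 1728) ≠ 3` ⟹ `ρ̄_{E,3ⁿ}` onto for all `n` (no side condition on the sign of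
  `v₃(j − 1728)`);
* `ClassX4.exotic_three_of_not_towerSurj_three` — the EXOTIC SIGNATURE: (w) ∧ `v₃(j − 1728) = 3` ∧
  `9 ∣ ord_q j` at every prime `q ≠ 3` with `ord_q j < 0`;
* `exotic_iff_exotic_of_three` and the END-STATE
  **`x4SharpUnitFree_iff_lower_and_residues_sharp_exoticThree_noL20`** — p251574's eight-fact X4
  end-state with the EXOTIC piece quantified only over the rows with that signature.

Census reading (EVIDENCE, `HOME/b2b-bsdres-n1011-p14/tb1/T-b1-ENGINE1-v1.4-ADDENDUM.md`): the 341
`r_an = 0` EXOTIC-candidate cells all have `v₃(j − 1728) = 3`; `v₃(N) = 5` on 210 of them (Kodaira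
II 58 / IV 33 / IV* 69 / II* 50) and `v₃(N) = 3` on 131 (II 60 / IV* 71); the 20 curves of
conductor `< 5·10⁵` on which the tower actually fails (Elkies) all have `v₃(N) = 5`, `v₃(j) ∈ {7, 8}`.
Nothing booked; X4 CONSTRUCTION-SHAPED; no label change.

RE-LAND (seat p14 gen 4, 2026-08-21): proof-text-identical resubmission of the accepted p268581 — its
accept-time `lake build` was blocked (rc 76) by a then-unbuilt dependency
(`GaloisImage/WildFiveThreeAdicTower`, repaired by p272202) and the module was never re-enqueued, so
no importer could elaborate; every declaration below is byte-identical to p268581.  Independent road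
to the `v₃(j − 1728) = 3` exclusion: n1011-p02's `Additive/X4ExoticValuationThree.lean` (p303047).

References: [Wuthrich2014] Lemma 20 (p. 399); [SerreAbelianLadic1968] IV §3.4 Lemma 3, A.1.2;
[Elkies2006] arXiv:math/0612734 §1; [Lang1987] Ch. 10 §4 Remark; [Kato2004Asterisque] Thm. 14.5 (3).
-/

noncomputable section

open scoped Classical

open WeierstrassCurve Literature.NumberTheory.EllipticCurves
  Literature.NumberTheory.EllipticCurves.ModularForms
  Literature.NumberTheory.EllipticCurves.Rank1Residual
  Literature.NumberTheory.EllipticCurves.Rank1Residual.Typed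
  Summit.BirchSwinnertonDyer.Rank1Residual.GaloisImage

namespace Summit.BirchSwinnertonDyer.Rank1Residual.Additive

section Three

variable {W : WeierstrassCurve ℚ} [W.IsElliptic] [W.IsGloballyMinimal]

omit [W.IsGloballyMinimal] in
/-- `j = 0` or `v₃(j) ≥ 1`, and `j ≠ 1728` ⟹ `v₃(j − 1728) ≥ 1` (`v₃(1728) = 3`;
`min (v₃ j) (v₃ 1728) ≤ v₃(j − 1728)` for `j − 1728 ≠ 0`). [folklore] -/
theorem padicValRat_j_sub_1728_pos [Fact (Nat.Prime 3)] (hj : W.j = 0 ∨ 0 < padicValRat 3 W.j)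
    (h1728 : W.j ≠ 1728) : 0 < padicValRat 3 (W.j - 1728) := by
  have h1728v : padicValRat 3 (-1728 : ℚ) = 3 := by rw [padicValRat.neg, padicValRat_three_1728]
  rcases hj with h0 | hpos
  · rw [h0, zero_sub, h1728v]; norm_num
  · have hne : W.j + (-1728) ≠ 0 := by rw [← sub_eq_add_neg]; exact sub_ne_zero.mpr h1728
    have hmin := padicValRat.min_le_padicValRat_add (p := 3) hne
    rw [← sub_eq_add_neg] at hmin
    refine lt_of_lt_of_le (lt_min hpos ?_) hmin
    rw [h1728v]; norm_num

/-- **EXOTIC ⟹ `v₃(j − 1728) = 3` EXACTLY.**  An X4 pair at `3` with `ρ̄_{E,3}` onto whose `3`-adic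
tower fails has `v₃(j − 1728) = 3` (Elkies' value): ARM A of T-b10 (n1011-p02,
`padicValRat_j_sub_eq_three_or_nonpos_of_not_towerSurj_three`) leaves `= 3 ∨ ≤ 0`; on the cell (w)
`≤ 0` means `= 0` (p264500), i.e. `v₃(j) = 0` or `j = 1728`; the former contradicts the
semistable-twist tower `ClassX4.j_eq_zero_or_padicValRat_j_pos_of_not_towerSurj` (p249389), the
latter surj(3) (`j_ne_1728_of_surj_three`: CM by `ℤ[i]`).
[cite: Wuthrich2014, Lemma 20 (p. 399)] [cite: SerreAbelianLadic1968, Ch. IV §3.4, Lemma 3 and A.1.2]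
[cite: Lang1987, Ch. 10 §4, Remark] -/
theorem ClassX4.padicValRat_j_sub_eq_three_of_not_towerSurj_three [Fact (Nat.Prime 3)]
    (hX : ClassX4 W 3) (hsurj : Surj W 3) (hnot : ¬ ∀ n : ℕ, W.HasSurjectiveModNGaloisRep (3 ^ n : ℕ)) :
    padicValRat 3 (W.j - 1728) = 3 := by
  rcases (ClassX4.exotic_arms_of_not_towerSurj_three hX hsurj hnot).2.1 with h | h
  · exact h
  · exfalso
    have hpos := padicValRat_j_sub_1728_pos
      (ClassX4.j_eq_zero_or_padicValRat_j_pos_of_not_towerSurj hX hsurj hnot)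
      (j_ne_1728_of_surj_three W hsurj)
    rw [h] at hpos
    exact lt_irrefl _ hpos

/-- **Contrapositive: on X4 at `3`, surj(3) ∧ `v₃(j − 1728) ≠ 3` ⟹ `ρ̄_{E,3ⁿ}` onto for every `n`**
(both arms of T-b10, T-b9, the semistable-twist tower and the `j = 1728` exclusion, with no side
condition on `v₃(j − 1728)`). [cite: SerreAbelianLadic1968, Ch. IV §3.4, Lemma 3 (IV-23)]
[cite: Wuthrich2014, Lemma 20 (p. 399)] -/
theorem ClassX4.towerSurj_three_of_surj_of_padicValRat_j_sub_ne [Fact (Nat.Prime 3)]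
    (hX : ClassX4 W 3) (hsurj : Surj W 3) (hne : padicValRat 3 (W.j - 1728) ≠ 3) (n : ℕ) :
    W.HasSurjectiveModNGaloisRep (3 ^ n : ℕ) := by
  by_contra hn
  exact hne (ClassX4.padicValRat_j_sub_eq_three_of_not_towerSurj_three hX hsurj fun h ↦ hn (h n))

/-- **THE EXOTIC SIGNATURE (gen 3).**  An X4 pair at `3` with `ρ̄_{E,3}` onto whose `3`-adic tower
FAILS lies in the wild cell (w) (`SubW W 3`), has `v₃(j − 1728) = 3` exactly, and has `9 ∣ ord_q j` at
every prime `q ≠ 3` with `ord_q j < 0` (ARM B, `ClassX4.exotic_signature_of_not_towerSurj_three`).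
[cite: Wuthrich2014, Lemma 20 (p. 399)] [cite: SerreAbelianLadic1968, Ch. IV §3.4, Lemma 3 and A.1.2] [cite: Elkies2006, §1] -/
theorem ClassX4.exotic_three_of_not_towerSurj_three [Fact (Nat.Prime 3)] (hX : ClassX4 W 3)
    (hsurj : Surj W 3) (hnot : ¬ ∀ n : ℕ, W.HasSurjectiveModNGaloisRep (3 ^ n : ℕ)) :
    SubW W 3 ∧ padicValRat 3 (W.j - 1728) = 3 ∧
    ∀ q : ℕ, q.Prime → q ≠ 3 → padicValRat q W.j < 0 → (9 : ℤ) ∣ padicValRat q W.j := by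
  obtain ⟨hS, -, h9⟩ := ClassX4.exotic_arms_of_not_towerSurj_three hX hsurj hnot
  exact ⟨hS, ClassX4.padicValRat_j_sub_eq_three_of_not_towerSurj_three hX hsurj hnot, h9⟩

end Three

/-! ### The X4 end-state with the EXOTIC piece on the `v₃(j − 1728) = 3` rows only -/

/-- **The EXOTIC hypothesis RESTRICTED to `v₃(j − 1728) = 3`.**  p251574's EXOTIC piece (`p = 3`,
`r_an = 0`, X4, surj(3), `ord₃ j ≥ 0`, `¬ TypeG W 3`, tower fails ⟹ upper) is EQUIVALENT to the same
statement on the rows with `SubW W 3`, `v₃(j − 1728) = 3` and `9 ∣ ord_q j` at every prime `q ≠ 3`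
with `ord_q j < 0`. [cite: Wuthrich2014, Lemma 20 (p. 399)] [cite: SerreAbelianLadic1968, Ch. IV §3.4, Lemma 3 (IV-23)]
[cite: Elkies2006, §1] -/
theorem exotic_iff_exotic_of_three :
    (∀ (W : WeierstrassCurve ℚ) [W.IsElliptic] [W.IsGloballyMinimal],
        W.analyticRank = 0 → ClassX4 W 3 → Surj W 3 → 0 ≤ padicValRat 3 W.j → ¬ TypeG W 3 →
        ¬ (∀ n : ℕ, W.HasSurjectiveModNGaloisRep (3 ^ n : ℕ)) → MissingUpperBoundAt W 3) ↔
    (∀ (W : WeierstrassCurve ℚ) [W.IsElliptic] [W.IsGloballyMinimal],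
        W.analyticRank = 0 → ClassX4 W 3 → Surj W 3 → SubW W 3 →
        padicValRat 3 (W.j - 1728) = 3 →
        (∀ q : ℕ, q.Prime → q ≠ 3 → padicValRat q W.j < 0 → (9 : ℤ) ∣ padicValRat q W.j) →
        ¬ (∀ n : ℕ, W.HasSurjectiveModNGaloisRep (3 ^ n : ℕ)) → MissingUpperBoundAt W 3) := by
  haveI : Fact (Nat.Prime 3) := ⟨Nat.prime_three⟩
  rw [exotic_iff_exotic_of_arms]
  constructor
  · intro h V _ _ hr hX hs hS h3 h9 hnot
    exact h V hr hX hs hS (Or.inl h3) h9 hnot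
  · intro h V _ _ hr hX hs hS _ h9 hnot
    exact h V hr hX hs hS (ClassX4.padicValRat_j_sub_eq_three_of_not_towerSurj_three hX hs hnot)
      h9 hnot

/-- **THE END-STATE OF CLASS X4 ON EIGHT NAMED FACTS with the EXOTIC piece on the
`v₃(j − 1728) = 3` rows only: X4♯(unit-free) ⟺ LOWER ∧ EXOTIC((w) ∧ `v₃(j − 1728) = 3` ∧ no
level-9 `j`-witness) ∧ TAM-DEFECT₂♭ ∧ ODD-SHA♭ ∧ MANIN♭** — p251574's
`x4SharpUnitFree_iff_lower_and_residues_sharp_exoticTypeG_noL20` rewritten along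
`exotic_iff_exotic_of_three`.  No named fact beyond the eight; X4 stays CONSTRUCTION-SHAPED;
nothing booked. [cite: Kato2004Asterisque, Thm. 14.5 (3) (p. 236), Thm. 17.4 (3) (p. 273)]
[cite: Delbourgo1998, Prop. 4 (p. 144)] [cite: Wuthrich2014, Lemma 20 (p. 399)] [cite: SilvermanAEC2009, Thm. X.4.14]
[cite: Kim2022StructureSelmer, Conj. 1.10 (PDF p. 8)] [cite: Miller2011LMS, Def. 1.1] [cite: Elkies2006, §1] -/
theorem x4SharpUnitFree_iff_lower_and_residues_sharp_exoticThree_noL20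
    (hCT : exists_casselsTate_pairing (K := ℚ))
    (hKatoS : Kato2004.rankZero_padicValNat_sha_le_sub_localTamagawa_of_additive_potGood_of_imageContainsSL2)
    (hDel : Delbourgo1998.prop4_rankZero_pow_dvd_constantCoeff)
    (hGZK : rank_eq_analyticRank_of_analyticRank_le_one) (hmod : hasEntireLFunction_rat)
    (hmodD : nonempty_modularParametrizationData)
    (hKatoχ : Wuthrich2014.kato_halfEigenCharIdeal_dvd_cyclotomicPrime_of_surjective)
    (hK : Kato2004.charIdeal_dvd_padicLFunctionBranch_component_of_surjective) :
    X4SharpUnitFree ↔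
      (∀ (W : WeierstrassCurve ℚ) [W.IsElliptic] [W.IsGloballyMinimal] (p : ℕ) [Fact p.Prime],
          W.analyticRank = 0 → ClassX4 W p → Surj W p → MissingLowerBoundAt W p) ∧
      (∀ (W : WeierstrassCurve ℚ) [W.IsElliptic] [W.IsGloballyMinimal],
          W.analyticRank = 0 → ClassX4 W 3 → Surj W 3 → SubW W 3 →
          padicValRat 3 (W.j - 1728) = 3 →
          (∀ q : ℕ, q.Prime → q ≠ 3 → padicValRat q W.j < 0 → (9 : ℤ) ∣ padicValRat q W.j) →
          ¬ (∀ n : ℕ, W.HasSurjectiveModNGaloisRep (3 ^ n : ℕ)) → MissingUpperBoundAt W 3) ∧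
      (∀ (W : WeierstrassCurve ℚ) [W.IsElliptic] [W.IsGloballyMinimal] (p : ℕ) [Fact p.Prime],
          W.analyticRank = 0 → ClassX4 W p → Surj W p → 0 ≤ padicValRat p W.j →
          ¬ (TypeGOrd W p ∧ semistabilityIndex W p = 2) →
          padicValNat p ((W.baseChange ℚ_[p]).localTamagawaNumber ℤ_[p]) + 2 ≤
            padicValNat p W.tamagawaProduct →
          MissingUpperBoundAt W p) ∧
      (∀ (W : WeierstrassCurve ℚ) [W.IsElliptic] [W.IsGloballyMinimal] (p : ℕ) [Fact p.Prime],
          W.analyticRank = 0 → ClassX4 W p → Surj W p → 0 ≤ padicValRat p W.j →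
          ¬ (TypeGOrd W p ∧ semistabilityIndex W p = 2) →
          (∃ q : ℚ, shaAn W = (q : ℂ) ∧ Odd (padicValRat p q)) → MissingUpperBoundAt W p) ∧
      (∀ (W : WeierstrassCurve ℚ) [W.IsElliptic] [W.IsGloballyMinimal] (p : ℕ) [Fact p.Prime],
          W.analyticRank = 0 → ClassX4 W p → Surj W p → 0 ≤ padicValRat p W.j →
          ¬ (TypeGOrd W p ∧ semistabilityIndex W p = 2) →
          (∀ (N : ℕ) [NeZero N] (D : ModularParametrizationData W N), (p : ℤ) ∣ D.maninConstant) →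
          MissingUpperBoundAt W p) := by
  rw [x4SharpUnitFree_iff_lower_and_residues_sharp_exoticTypeG_noL20 hCT hKatoS hDel hGZK hmod hmodD
    hKatoχ hK, exotic_iff_exotic_of_three]

end Summit.BirchSwinnertonDyer.Rank1Residual.Additive

end
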